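import Summits.PneNP.PneNP.Theorems.ChebyshevTracialDesignTightOddLayers
import Summits.PneNP.PneNP.Theorems.ChebyshevTracialDesignDipoleSquareSum
import HarnessLib

/-!
# Cell pnp-psdrank, route `ChebyshevTracialDesign`: the even ladder eigenvalues of the tight Gram kernel in closed form
# (MEMO-7 (★★))

Harmonic backbone, brick 5e — the assembly of (★★). For the tight incidence `A(U,M) = 1[cc(U,M) = 1]` between the
`t`-subsets (`t = 2c+1`, `2t ≤ n`) and the perfect matchings of `K_n` [cite: Rothvoss2017, §2 (PDF p. 6)] with Gram class function
`κ`, the ladder eigenvalue on the even Johnson layer `2κ' ≤ t − 1` is, EXACTLY,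
  `kernelEigen n t (2κ') κ · Π_{i < t−2κ'} λ_{2κ'}(i) = ((t−2κ')! · (n−t+1−2κ') · C(n/2−2κ', c−κ'))² · Σ_{d even} C(2κ',d)·pm(2κ'−d)·pm(d)²·pm(n−2κ'−d)`
(`kernelEigen_tight_even_mul_ladderProd`; `pm = pmCount`, `pm(2m) = (2m−1)‼`; `λ_j(i) = (i+1)(n−2j−i)` the ladder norms), hence the
division form `kernelEigen_tight_even_eq`. Inputs: brick 5c (`kernelEigen_tight_even_mul`: the Gram layer identity evaluated on the
dipole test vector, with the tight column sums of bricks 4b/5a) and eng g7's matching-side count `sum_sq_dipoleFunctional` (p444030: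
`Σ_M Π_χ(M)² = 2^{2κ'}·Σ_{d even} C(2κ',d) pm(2κ'−d) pm(d)² pm(n−2κ'−d)`, four-block `card_blockPM`). Check: `n = 10, t = 5, κ' = 1`:
`(3!·4·3)²·120/720 = 864` = the brute-force eigenvalue (MEMO-7 §2). Together with `kernelEigen_tight_eq_zero_of_odd` (5c) this is the
complete ladder spectrum of the tight relation; `…TightFreeSpectral` (5d) turns any bound `Λ` on these numbers into
`|X|·|Y|·d_C² ≤ Λ·C(n,t)(C(n,t)−|X|)` for tight-free rectangles [cite: GodsilMeagher2015, §15.2 (perfect matching scheme)].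
WHAT THIS IS NOT: the inequality `max_{κ'≥1} = κ' = 1` (R3) is not proved here; nothing on psd rank. Supports crux stmt-PneNP-19878.
-/

set_option linter.dupNamespace false -- `Summit.PneNP.PneNP.…`: summit = sub-problem (D-0017)

noncomputable section

namespace Summit.PneNP.PneNP.Theorems.ChebyshevTracialDesignTightEvenEigenvalues

open Finset Literature.Combinatorics.AssociationSchemes Literature.Combinatorics.AssociationSchemes.JohnsonHarmonics
open Literature.Combinatorics.AssociationSchemes.JohnsonSpectrum
open Literature.Barriers.PneNP
open Summit.PneNP.PneNP.Theorems.ChebyshevTracialDesignTightOddLayers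
open Summit.PneNP.PneNP.Theorems.ChebyshevTracialDesignDipoleSquareSum

variable {n : ℕ}

/-- **(★★), product form.** For `t = 2c+1` with `2t ≤ n`, `κ' ≤ c`, and `κ` the Gram class function of the tight incidence on the
`t`-subsets: `kernelEigen n t (2κ') κ · (Π_{i<t−2κ'} λ_{2κ'}(i)) · 2^{2κ'} =
((t−2κ')!·(n−2c−2κ')·C(n/2−2κ', c−κ'))² · 2^{2κ'} · Σ_{d ≤ 2κ', d even} C(2κ',d) pm(2κ'−d) pm(d)² pm(n−2κ'−d)`. -/
theorem kernelEigen_tight_even_mul_ladderProd {c κ' : ℕ} (ht : 2 * (2 * c + 1) ≤ n) (hκc : κ' ≤ c) (κ : ℕ → ℝ)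
    (hA : ∀ U ∈ univ.powersetCard (2 * c + 1), ∀ U' ∈ univ.powersetCard (2 * c + 1),
      ∑ M : PMatch n, (if (U.filter fun x => M.2.partner x ∉ U).card = 1 then (1 : ℝ) else 0) *
        (if (U'.filter fun x => M.2.partner x ∉ U').card = 1 then (1 : ℝ) else 0) = κ (U ∩ U').card) :
    kernelEigen n (2 * c + 1) (2 * κ') κ *
        ((∏ i ∈ range (2 * c + 1 - 2 * κ'), ladder n (2 * κ') i) * (2 : ℝ) ^ (2 * κ')) =
      (((2 * c + 1 - 2 * κ').factorial : ℝ) *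
          (((n : ℝ) - (2 * c : ℕ) - (2 * κ' : ℕ)) * (((n / 2 - 2 * κ').choose (c - κ') : ℕ) : ℝ))) ^ 2 *
        ((2 : ℝ) ^ (2 * κ') * ∑ d ∈ range (2 * κ' + 1),
          if Even d then ((2 * κ').choose d : ℝ) * pmCount (2 * κ' - d) * pmCount d ^ 2 * pmCount (n - 2 * κ' - d)
          else 0) := by
  obtain ⟨ha, hb, hab⟩ := standardDipoles_props (n := n) (j := 2 * κ') (by omega)
  have hp := isHarmonic_dipoleVec ha hb hab
  have h5c := kernelEigen_tight_even_mul ht hκc (by omega) κ hA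
  rw [ip_iterate_up_of_isHarmonic hp, ip_dipoleVec_self _ _ _ ha hb hab] at h5c
  rw [h5c, ← sum_sq_dipoleFunctional ha hb hab, mul_sum]
  exact sum_congr rfl fun M _ => by ring


/-- **(★★), closed form.** Under the same hypotheses,
`kernelEigen n t (2κ') κ = ((t−2κ')!·(n−2c−2κ')·C(n/2−2κ', c−κ'))² · Σ_{d even} C(2κ',d) pm(2κ'−d) pm(d)² pm(n−2κ'−d) / Π_{i<t−2κ'} λ_{2κ'}(i)`
(the ladder product is positive for `2t ≤ n`). -/
theorem kernelEigen_tight_even_eq {c κ' : ℕ} (ht : 2 * (2 * c + 1) ≤ n) (hκc : κ' ≤ c) (κ : ℕ → ℝ)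
    (hA : ∀ U ∈ univ.powersetCard (2 * c + 1), ∀ U' ∈ univ.powersetCard (2 * c + 1),
      ∑ M : PMatch n, (if (U.filter fun x => M.2.partner x ∉ U).card = 1 then (1 : ℝ) else 0) *
        (if (U'.filter fun x => M.2.partner x ∉ U').card = 1 then (1 : ℝ) else 0) = κ (U ∩ U').card) :
    kernelEigen n (2 * c + 1) (2 * κ') κ =
      (((2 * c + 1 - 2 * κ').factorial : ℝ) *
          (((n : ℝ) - (2 * c : ℕ) - (2 * κ' : ℕ)) * (((n / 2 - 2 * κ').choose (c - κ') : ℕ) : ℝ))) ^ 2 *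
        (∑ d ∈ range (2 * κ' + 1),
          if Even d then ((2 * κ').choose d : ℝ) * pmCount (2 * κ' - d) * pmCount d ^ 2 * pmCount (n - 2 * κ' - d)
          else 0) /
        ∏ i ∈ range (2 * c + 1 - 2 * κ'), ladder n (2 * κ') i := by
  have hprod : 0 < ∏ i ∈ range (2 * c + 1 - 2 * κ'), ladder n (2 * κ') i :=
    ladderProd_range_pos (by omega) ht
  have h2 : (0 : ℝ) < (2 : ℝ) ^ (2 * κ') := by positivity
  have h := kernelEigen_tight_even_mul_ladderProd ht hκc κ hA
  rw [eq_div_iff hprod.ne']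
  refine mul_right_cancel₀ h2.ne' ?_
  rw [mul_assoc, h]
  ring

end Summit.PneNP.PneNP.Theorems.ChebyshevTracialDesignTightEvenEigenvalues
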